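import Mathlib
import Summits.ValiantsHypothesis.ValiantsHypothesis.Theorems.ContractivityPricePriceOfContractivityStubNCauchyCoeff
import Summits.ValiantsHypothesis.ValiantsHypothesis.Theorems.ContractivityPricePriceOfContractivityStubNGramStein
import Summits.ValiantsHypothesis.ValiantsHypothesis.Theorems.ContractivityPricePriceOfContractivityStubNContraction
import Summits.ValiantsHypothesis.ValiantsHypothesis.Theorems.ContractivityPricePriceOfContractivityStubNAssembly
import HarnessLib

/-!
# Crux `PriceOfContractivity` (stmt-ValiantsHypothesis-10583), line `registered` — stub
# `stub_normHalvingOne_oneClassOneSingleton` (norm halving `NH₁` for ONE colour class plus ONE further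
# row, UNCONDITIONAL)

Route `ValiantsHypothesis/ContractivityPrice`, crux K1
(`Summit.ValiantsHypothesis.ValiantsHypothesis.Theses.ContractivityPrice.PriceOfContractivity`).  The open
composing stub `stub_normHalvingOne` (`NH₁`) of the lead's skeleton asks: a Sylvester pencil
`1 + diag (X ∘ κ) · K` with `‖K‖_op ≤ 2` whose determinant has no zero on the closed polydisc of radius `2`
is re-realized, at size `R' ≤ 2 ^ ((log₂ n + c) ^ c) · R`, by a matrix `K'` with `‖K'‖_op ≤ 1`.

This file closes the registered partial case `stub_normHalvingOne_oneClassOneSingleton` (skeleton rev 17,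
lead c4): all rows but at most one carry one colour `x` (profiles `(n)` and `(n, 1)`; Doyle's
`2S + F ≤ 3` regime with `S = F = 1`), UNCONDITIONALLY, with `c = 2` (size `R' ≤ R + 2`), by the WEIGHTED
MODEL-SPACE COLLIGATION: writing the pencil determinant as `a(ξ) + y · b(ξ)` (`a = det (1 + ξA)`,
`|b| ≤ |a|/2` on `|ξ| ≤ 2`), `φ = b/a` is realized on the model space `{u/a : deg u ≤ N+1}` normed by
`‖g‖² = Σ_k |ĝ(k)|² 2^k`, whose backward shift `S` satisfies the Stein identity
`‖g‖² = |g(0)|² + 2‖Sg‖²`; Cauchy's estimate gives `‖φ‖² ≤ 1/2`, and the colligation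
`[[−TST⁻¹, √2 T(Sφ)], [−(1/√2) ev₀ T⁻¹, φ(0)]]` (`T*T` = Gram matrix) is a contraction whose `x`-block
has characteristic polynomial EXACTLY `a` and whose Schur complement is `φ`.  The four pieces are the
landed `stubN_cauchyCoeff` (N1), `stubN_gramStein` (N2), `stubN_contraction` (N3), `stubN_assembly`
(N4, which takes N1–N3 as hypotheses); this file is the one-line composition.  Folklore one-variable
function theory and linear algebra; no cited facts.
-/

noncomputable section

-- `Summit.<Summit>.<Problem>` repeats `ValiantsHypothesis` by the tree's layout convention (D-0017).
set_option linter.dupNamespace false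

namespace Summit.ValiantsHypothesis.ValiantsHypothesis.Theorems.PriceOfContractivity.NormHalvingModelSpace

open Matrix

/-- **Registered partial case of the norm halving `NH₁` (crux `PriceOfContractivity`, line `registered`,
stub `stub_normHalvingOne_oneClassOneSingleton`): one colour class plus at most one further row,
UNCONDITIONAL, `c = 2`.**  If all rows of the Sylvester pencil but at most one carry the same colour,
then a re-realization with `‖K'‖_op ≤ 1` exists at size `R' ≤ 2 ^ ((log₂ n + 2) ^ 2) · R` (in fact
`R' ≤ R + 2`).  Composition of the landed pieces N4 (assembly) with N1 (Cauchy coefficient bound), N2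
(Gram matrix / Stein identity) and N3 (the contraction). [folklore: weighted model-space (de
Branges–Rovnyak-type) colligation; this line's construction, NOTES.md §M1 of lead c4] -/
theorem stub_normHalvingOne_oneClassOneSingleton :
    ∃ c : ℕ, ∀ (n R : ℕ) {σ : Type} [Fintype σ] (K : Matrix (Fin R) (Fin R) ℂ) (κ : Fin R → σ),
      (∃ x : σ, Nat.card {i : Fin R // κ i ≠ x} ≤ 1) →
      R ≤ 2 ^ ((Nat.log 2 n + c + 2) ^ (c + 2)) →
      Fintype.card σ ≤ n →
      (1 + Matrix.diagonal (fun i => MvPolynomial.X (κ i)) * K.map (fun a : ℂ => (MvPolynomial.C a : MvPolynomial σ ℂ))).det.totalDegree ≤ n →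
      ‖Matrix.toEuclideanCLM (𝕜 := ℂ) K‖ ≤ 2 →
      (∀ z : σ → ℂ, (∀ j, ‖z j‖ ≤ 2) → MvPolynomial.eval z (1 + Matrix.diagonal (fun i => MvPolynomial.X (κ i)) * K.map (fun a : ℂ => (MvPolynomial.C a : MvPolynomial σ ℂ))).det ≠ 0) →
      ∃ R' ≤ 2 ^ ((Nat.log 2 n + c) ^ c) * R, ∃ (K' : Matrix (Fin R') (Fin R') ℂ) (κ' : Fin R' → σ),
        ‖Matrix.toEuclideanCLM (𝕜 := ℂ) K'‖ ≤ 1 ∧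
        (1 + Matrix.diagonal (fun i => MvPolynomial.X (κ i)) * K.map (fun a : ℂ => (MvPolynomial.C a : MvPolynomial σ ℂ))).det =
          (1 + Matrix.diagonal (fun i => MvPolynomial.X (κ' i)) * K'.map (fun a : ℂ => (MvPolynomial.C a : MvPolynomial σ ℂ))).det :=
  stubN_assembly stubN_cauchyCoeff stubN_gramStein stubN_contraction

end Summit.ValiantsHypothesis.ValiantsHypothesis.Theorems.PriceOfContractivity.NormHalvingModelSpace
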